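import Mathlib
import HarnessLib
import Summits.BirchSwinnertonDyer.BirchSwinnertonDyer.Theses.ManinLocalTwoThree
import Summits.BirchSwinnertonDyer.BirchSwinnertonDyer.Theorems.ManinLocalTwoThreeKummerDiamondIndexFourShapeNoCES
import Literature.NumberTheory.Automorphic.UnboundedDenominators

/-!
# Lines/kummer_diamond_noCES_candidate.lean — v7 CANDIDATE (width seat p2 gen 22, 2026-08-30T06:2xZ): C2 `ManinOddAtFour` ⟸ TWO PRINTED FACTS {CDT, T-es-75}

Offered to the LEAD (line of record `Lines/kummer_diamond.lean` v6 has stubs {stub_CDT, stub_CES, stub_Tes75}).  The stub `stub_CES`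
(`exists_optimal_gamma1ParametrizationData`, Conrad–Edixhoven–Stein 2003) is NOT needed: in E-es-185♭'s world (`|c₀| = 2`, `Λ₁(f) = 2Λ₀(f)`)
the `X₀(N)`-optimal curve `W₀` ITSELF carries an optimal `X₁(N)`-datum (p2 gen 22 `FlatGamma1Datum.exists_flat_gamma1ParametrizationData`,
p763227: `Λ_{W₀} = c₀Λ₀ = (c₀/2)·Λ₁`, degree field from a `Γ₁(N)` twin of `exists_modularDegree_holds`), so THEOREM K♮ (es `kummerDiamondReciprocity`,
⟸ T-es-75) applies to it directly (`KummerDiamondIndexFourNoCES.indexFour_kummerDiamondReciprocity_of_even`, p763417) and the LEAD's flat assembly runs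
with THEOREM K's conclusion as its only input (`two_pow_five_dvd_and_hasFreyTwistShape_of_kummerValues`, fact-free).

* `stub_CDT`   — Calegari–Dimitrov–Tang 2025 Thm 1.0.1 (unbounded denominators), statement-only;
* `stub_Tes75` — T-es-75 `optimalGamma1Parametrization_cuspInv_galoisAction` (Stevens 1982 Thm 1.3.1(b)), statement-only.

COMPOSITION (no sorry): `KummerDiamondIndexFourNoCES.maninOddAtFour_of_CDT_Tes75 stub_CDT stub_Tes75` (p763417) =
`CDivTranslate.maninOddAtFour_of_CDTInt_shape185Flat stub_CDT (KummerDiamondIndexFourNoCES.shape185Flat_of_Tes75 stub_Tes75)`.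

HONEST FRAMING: C2 is proved CONDITIONALLY on two named, printed, statement-only Literature facts; the item `ManinOddAtFour`
(stmt-BirchSwinnertonDyer-22967) does NOT close by name unless the planner adds these binders (ROUTE EDIT 3, now {CDT, T-es-75}) or the facts are
discharged.  Whole route: `KummerDiamondIndexFourNoCES.maninConstantOne_of_sixPrintedFacts` (Mazur 78, Abbes–Ullmo 96, Česnavičius 18, modularity,
CDT 25, Stevens 82 (b)).  BSD is not proved; Manin's conjecture is not proved.
-/

set_option autoImplicit false
set_option linter.dupNamespace false

noncomputable section

open Literature.NumberTheory.EllipticCurves.ModularForms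

namespace Summit.BirchSwinnertonDyer.BirchSwinnertonDyer.Cruxes.ManinOddAtFour.KummerDiamondNoCESLine

/-- STUB (PRINTED) CDT Theorem 1.0.1 (`CalegariDimitrovTang2025_unboundedDenominators`); CITE-ONLY. -/
theorem stub_CDT : Literature.NumberTheory.Automorphic.CalegariDimitrovTang2025_unboundedDenominators := by
  sorry

/-- STUB (PRINTED) T-es-75 — Stevens 1982 Thm 1.3.1(b) (Galois action on the cusps `[1;y]` of `X₁(N)`); CITE-ONLY. -/
theorem stub_Tes75 : optimalGamma1Parametrization_cuspInv_galoisAction := by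
  sorry

/-- COMPOSITION (no sorry): p2 gen 22 `KummerDiamondIndexFourNoCES.maninOddAtFour_of_CDT_Tes75` (E-es-185♭ ⟸ T-es-75 by the flat `X₁(N)`-datum
and the kummer_diamond assembly; C2 ⟸ CDT ∧ E-es-185♭ by p3's flat composition with p2's E-es-186♭). -/
theorem ManinOddAtFour_of :
    Summit.BirchSwinnertonDyer.BirchSwinnertonDyer.Theses.ManinLocalTwoThree.ManinOddAtFour :=
  Summit.BirchSwinnertonDyer.BirchSwinnertonDyer.Theorems.ManinLocalTwoThree.KummerDiamondIndexFourNoCES.maninOddAtFour_of_CDT_Tes75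
    stub_CDT stub_Tes75

end Summit.BirchSwinnertonDyer.BirchSwinnertonDyer.Cruxes.ManinOddAtFour.KummerDiamondNoCESLine

end
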